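import Summits.CriticalPhenomena.PercolationContinuityZ3.Theorems.PercAnnulusCrossingBoxCrossingDefs2
import Summits.CriticalPhenomena.PercolationContinuityZ3.Theorems.PercAnnulusCrossingLandingSecondMoment
import HarnessLib

/-!
# RSW3 lane: the typed landing criterion — `LandingSecondMoment k → HardCrossingLowerBound k`

builds on p205010 (kernel theorem, internal audit signed; external expert review pending)

RSW3 lane (LANE 3 `prim-rsw3`), lead seat, gen 5.  Helper file (`--supports`); no definitions, no named facts, no sorries.
Bridges the typed Props of `PercAnnulusCrossingBoxCrossingDefs2` v4 (`Crossing.LandingSecondMomentAt p k K`: `E[L²] ≤ K·E[L]²` and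
`E[L] > 0` for the landing footprint of `{0..kn}×{0..n}²`, every `n ≥ 1`; `LandingSecondMoment k := ∃ K > 0, … at p_c`) to the kernel
criterion `Crossing.hardCrossingLowerBound_of_landing_secondMoment` (Cauchy–Schwarz on `{L ≥ 1} = {block crossed}`), so that the
completed wall W5 reads as one implication between named nodes; `k = 1` is the cube.
[cite: LyonsPeres2016, §5.3 Prop. 5.11] [cite: Kesten1982, §3.3 (3.32)]
-/

noncomputable section

namespace Summit.CriticalPhenomena.PercolationContinuityZ3.Theorems.Crossing

open MeasureTheory Literature.Probability.LatticeModels Literature.Probability.Percolation SimpleGraph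
open Summit.CriticalPhenomena.PercolationContinuityZ3.Theorems.SurfaceTension

/-- **`LandingSecondMomentAt p_c k K → HardCrossingLowerBound k`** (`K > 0`), constant `1/K`. [cite: LyonsPeres2016, §5.3 Prop. 5.11] -/
theorem hardCrossingLowerBound_of_landingSecondMomentAt {k : ℕ} {K : ℝ} (hK : 0 < K)
    (h : LandingSecondMomentAt (criticalProbI 3) k K) : HardCrossingLowerBound k :=
  hardCrossingLowerBound_of_landing_secondMoment hK h

/-- **`LandingSecondMoment k → HardCrossingLowerBound k`** — wall W5 as one implication between typed nodes; `k = 1`: pair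
quasi-multiplicativity of face-to-point connectivities in the cube ⇒ uniform cube crossing at `p_c(ℤ³)`.
[cite: LyonsPeres2016, §5.3 Prop. 5.11] [cite: Kesten1982, §3.3 (3.32)] -/
theorem hardCrossingLowerBound_of_landingSecondMoment {k : ℕ} (h : LandingSecondMoment k) : HardCrossingLowerBound k := by
  obtain ⟨K, hK, hKk⟩ := h
  exact hardCrossingLowerBound_of_landingSecondMomentAt hK hKk

/-! ## Appended (lead gen 5): the cube instance, literally -/

/-- `hardShape 1 = cubeShape` (the `1:1` "hard" shape `(1·n, n, n)` is the cube). [cite: Kesten1982, §3.3 (3.28)] -/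
theorem hardShape_one_eq_cubeShape : hardShape 1 = cubeShape := by
  funext n
  ext j
  fin_cases j <;> simp [hardShape, cubeShape]

/-- `HardCrossingLowerBound 1 ↔ CrossingLowerBound cubeShape 0` — the `k = 1` hard-direction statement IS the lane's cube lower
bound (S1-lo-hard, cube). [cite: Kesten1982, §3.3 (3.28)] -/
theorem hardCrossingLowerBound_one_iff : HardCrossingLowerBound 1 ↔ CrossingLowerBound cubeShape 0 := by
  unfold HardCrossingLowerBound
  rw [hardShape_one_eq_cubeShape]

/-- **`LandingSecondMoment 1 → CrossingLowerBound cubeShape 0`**: pair quasi-multiplicativity of the face-to-point function in the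
cube (`E[L²] ≤ K·E[L]²` for the landing footprint, uniformly in `n`) gives the uniform CUBE crossing bound at `p_c(ℤ³)` — the two-point
normal form of the lane's central open statement (wall W5 completed; census R22f: `K ≈ 6.3` flat, non-rigorous).
[cite: LyonsPeres2016, §5.3 Prop. 5.11] [cite: Kesten1982, §3.3 (3.32)] -/
theorem crossingLowerBound_cubeShape_of_landingSecondMoment_one (h : LandingSecondMoment 1) :
    CrossingLowerBound cubeShape 0 :=
  hardCrossingLowerBound_one_iff.1 (hardCrossingLowerBound_of_landingSecondMoment h)

end Summit.CriticalPhenomena.PercolationContinuityZ3.Theorems.Crossing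

end
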